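import Summits.CriticalPhenomena.SAWScalingLimit.Theorems.SAWCircleScreeningScreeningRecursion

/-!
# Line `birth` — registered skeleton for the crux `EndpointCoupling` (stmt-CriticalPhenomena-5465)

Crux (FIXED; rank 5 of `route-CriticalPhenomena-SAWCircleScreening`, sub-problem `SAWScalingLimit`):
for every Dobrushin domain `D` and ANY two endpoint approximations `(a, b)`, `(a′, b′)`
(`SAW.IsEndpointApprox`) the critical SAW laws of `D_δ`, pushed to `CurveClass ℂ`, are
asymptotically equal: `d_LP(law_δ(a_δ, b_δ) ∘ curve⁻¹, law_δ(a′_δ, b′_δ) ∘ curve⁻¹) → 0` as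
`δ → 0⁺`. General Jordan geometry at the marked points (the flat case is the route's support item
`EndpointCouplingTame`, closed by the proved engine `ScreeningRecursion`).

## The cut: TAIL MEMORY LOSS (after the last exit of a small ball, in total variation) +
## START CONFINEMENT (no deep return to the marked point) — at ONE marked point; the second marked
## point is reached by exact lattice reversibility (proved), the two laws by the triangle inequality.

Fix the first marked point `c = D.pt 0` and a radius `R > 0`. The EXIT TAIL of a lattice walk is
its maximal final segment outside the open ball `B(c, R)` — the vertices after the LAST visit to
`B(c, R)` (`List.rtakeWhile (R ≤ dist (δ·w) c)` of the support). Two walks with the SAME exit tail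
whose earlier parts both stay in `B(c, s)` have curve classes within `2s` (tree:
`dist_curve_le_of_common_suffix`); and a walk started inside `B(c, R)` keeps its pre-tail part inside
`B(c, s)` exactly when it makes NO DEEP RETURN (never comes back within `R` of `c` after reaching
distance `s`). Hence (tree: `levyProkhorovEDist_map_le_of_tail`, a sentinel-valued tail observable)

  `d_LP ≤ max (2s) (TV(exit-tail laws) + P(deep return) + P′(deep return))`,

which splits the crux at `D.pt 0` into two lattice statements of different nature, both stated
ALONG endpoint approximations (the crux's own quantifier shape; no uniform constants):

* S1 `stub_tailCoupling` (LOAD-BEARING; the SAW estimate) — TAIL MEMORY LOSS: for approximations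
  `a, a′` of `D.pt 0` with a common target approximation `b` of `D.pt 1`, every `R > 0` and
  `ε > 0`, eventually as `δ → 0⁺` the laws of the exit tails out of `B(D.pt 0, R)` under
  `law_δ(a_δ, b_δ)` and `law_δ(a′_δ, b_δ)` are `ε`-close on every set of lattice paths (total
  variation). By exact reversibility this is TARGET INSENSITIVITY OF THE ENTRANCE LAW: the critical
  SAW from `b_δ`, observed until it first enters `B(D.pt 0, R)`, does not feel in total variation
  where inside a vanishing neighbourhood of `D.pt 0` its endpoint sits — a ratio-limit statement
  `Z_{Ω∖ω}(y → a_δ) / Z_{Ω∖ω}(y → a′_δ) ≈ const(a_δ, a′_δ)` uniformly in the outside data `(ω, y)`,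
  which the route's screens (maximal coupling of single-crossing data across the scales between
  `|δ a_δ − c|` and `R`, their number → ∞) are designed to produce; NOT implied by the conjunct.
  Size XL.
* S2 `stub_startConfinement` — NO DEEP RETURN TO THE START: for an approximation `(a, b)`, every
  `s > 0` and `ε > 0` there is `R > 0` such that eventually as `δ → 0⁺` the `law_δ(a_δ, b_δ)`-mass
  of walks that reach distance `≥ s` from `D.pt 0` and later come back within `< R` of it is
  `≤ ε`. In kind a CONSEQUENCE of the conjunct (portmanteau on a closed curve event + chordal
  SLE_{8/3} does not revisit its starting prime end), i.e. necessary; on the lattice it is the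
  qualitative, per-domain, concentric-at-the-start shadow of the route's crux `NoDeepReturn`.
  Size L.

`EndpointCoupling_of` (kernel-checked, no `sorry` of its own; ~400 lines with its lemmas): S1+S2 ⇒
one-endpoint coupling at `D.pt 0` for EVERY Dobrushin domain (`startCoupling_of`: constants
`s = ε/8`, `R = min(R₁, R₂, s/2, |pt 1 − pt 0|/2)`; the lattice lemmas `dist_lt_of_mem_rdropWhile`,
`exitTail_spec`, `dist_curve_le_of_exitTail_eq`; the fixed-mesh bound `levyProkhorovEDist_le_of_tails`
with its sentinel tail observable, via the tree's `levyProkhorovEDist_map_le_of_tail`);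
then the crux by the tree's reversal bookkeeping (`isEndpointApprox_cross`, the swapped domain
`MarkedDomain.swap`, `isEndpointApprox_swap`, `map_curve_law_swap`, the isometry
`CurveClass.reverse`, `levyProkhorovDist_triangle` past the junk meshes).

Why two stubs and not one: S1 alone does not control the curves (the pre-tail part may make
macroscopic excursions that differ for the two starts); S2 alone compares nothing. The FIRST-exit
tail would make S2 unnecessary (`dist_curve_le_of_drop_eq`) — that single-stub cut is deliberately
not taken: S1 is the weakest memory-loss statement (last exit) and S2 carries the confinement.

Disproof used: none exists for this crux (`ledger crux ls stmt-CriticalPhenomena-5465`: no workfiles,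
2026-08-17). Negatives index checked (see `Lines/birth.md`): every statement here is eventual
(`∀ᶠ δ in 𝓝[>] 0`), so the refuted all-`δ` tightness shape (stmt-CriticalPhenomena-0772) is avoided.
Necessity guard: `endpointCoupling_of_sawScalingLimit` (tree) shows the crux follows from the
conjunct, so the BC3 probes are run against BOTH the crux and `SAWScalingLimit`.
-/

noncomputable section

open MeasureTheory Filter Topology Set Metric
open scoped ENNReal NNReal
open Literature.Probability.RandomPlanarGeometry Literature.Probability.RandomPlanarGeometry.SAW
open Literature.Probability.LatticeModels
open Summit.CriticalPhenomena.SAWScalingLimit.Theorems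
open Summit.CriticalPhenomena.SAWScalingLimit.Theorems.ScreeningRecursion
open Summit.CriticalPhenomena.SAWScalingLimit.Theorems.SubseqIdentification.Negative
open Summit.CriticalPhenomena.SAWScalingLimit.Theses.SAWCircleScreening

namespace Summit.CriticalPhenomena.SAWScalingLimit.Cruxes.EndpointCoupling.Birth

/-! ### Vocabulary of the line -/

/-- **The exit tail** of a vertex list out of the open ball `B(c, R)` at mesh `δ`: its maximal final
segment all of whose mesh points lie at distance `≥ R` from `c` — the part of a walk after its LAST
visit to `B(c, R)`. (Inlined verbatim in the stubs.) -/
def exitTail (δ R : ℝ) (c : ℂ) (l : List (Site 2)) : List (Site 2) :=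
  l.rtakeWhile fun w => decide (R ≤ dist (meshPoint δ w) c)

/-- **S1, named.** Tail memory loss at the first marked point, in total variation, along endpoint
approximations (see the module docstring). -/
def TailCoupling : Prop :=
  ∀ (D : DobrushinDomain) (a a' b : ℝ → Site 2), IsEndpointApprox D a b → IsEndpointApprox D a' b →
    ∀ (R ε : ℝ), 0 < R → 0 < ε →
      ∀ᶠ δ in 𝓝[>] (0 : ℝ), ∀ T : Set (List (Site 2)),
        law D.carrier δ (a δ) (b δ)
            {γ | γ.walk.support.rtakeWhile (fun w => decide (R ≤ dist (meshPoint δ w) (D.pt 0))) ∈ T} ≤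
          law D.carrier δ (a' δ) (b δ)
            {γ | γ.walk.support.rtakeWhile (fun w => decide (R ≤ dist (meshPoint δ w) (D.pt 0))) ∈ T} +
            ENNReal.ofReal ε

/-- **S2, named.** No deep return to the first marked point, along an endpoint approximation (see
the module docstring). -/
def StartConfinement : Prop :=
  ∀ (D : DobrushinDomain) (a b : ℝ → Site 2), IsEndpointApprox D a b →
    ∀ (s ε : ℝ), 0 < s → 0 < ε →
      ∃ R : ℝ, 0 < R ∧ ∀ᶠ δ in 𝓝[>] (0 : ℝ),
        law D.carrier δ (a δ) (b δ)
            {γ | ∃ i i' : ℕ, i < i' ∧ i' ≤ γ.walk.length ∧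
              s ≤ dist (meshPoint δ (γ.walk.getVert i)) (D.pt 0) ∧
              dist (meshPoint δ (γ.walk.getVert i')) (D.pt 0) < R} ≤ ENNReal.ofReal ε

/-- **One-endpoint coupling at the first marked point** (the intermediate statement of the line,
NOT a stub): two approximations of `D.pt 0` with a common target approximation have asymptotically
`d_LP`-equal critical SAW laws on curve classes. -/
def StartCoupling : Prop :=
  ∀ (D : DobrushinDomain) (a a' b : ℝ → Site 2), IsEndpointApprox D a b → IsEndpointApprox D a' b →
    Tendsto (fun δ => levyProkhorovDist
      ((law D.carrier δ (a δ) (b δ)).map fun γ => γ.curve)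
      ((law D.carrier δ (a' δ) (b δ)).map fun γ => γ.curve)) (𝓝[>] (0 : ℝ)) (𝓝 0)

/-! ### The stubs (the ONLY `sorry`s of this file)

Both are stated over TREE VOCABULARY ONLY (`exitTail` unfolded by hand), so that each lands verbatim
as a `Theorems/…` file `--supports stmt-CriticalPhenomena-5465` without importing this workfile; the
`*_holds` theorems below certify definitionally that the unfolded text IS the named statement. -/

/-- **S1 — tail memory loss at the first marked point (total variation, along approximations).**
For every Dobrushin domain `D`, approximations `a, a′` of `D.pt 0` and `b` of `D.pt 1`
(`IsEndpointApprox D a b`, `IsEndpointApprox D a′ b`), every radius `R > 0` and every `ε > 0`: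
eventually as `δ → 0⁺`, for every set `T` of lattice paths, the `law_δ(a_δ, b_δ)`-probability that
the exit tail of the walk out of `B(D.pt 0, R)` (its maximal final segment at distance `≥ R` from
`D.pt 0`) lies in `T` exceeds the `law_δ(a′_δ, b_δ)`-probability of the same event by at most `ε`.
(Equivalently, by reversibility: the entrance law into `B(D.pt 0, R)` of the critical SAW from
`b_δ` is insensitive in total variation to the position of its target near `D.pt 0`.) -/
theorem stub_tailCoupling :
    ∀ (D : DobrushinDomain) (a a' b : ℝ → Site 2), IsEndpointApprox D a b → IsEndpointApprox D a' b →
      ∀ (R ε : ℝ), 0 < R → 0 < ε →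
        ∀ᶠ δ in 𝓝[>] (0 : ℝ), ∀ T : Set (List (Site 2)),
          law D.carrier δ (a δ) (b δ)
              {γ | γ.walk.support.rtakeWhile (fun w => decide (R ≤ dist (meshPoint δ w) (D.pt 0))) ∈ T} ≤
            law D.carrier δ (a' δ) (b δ)
              {γ | γ.walk.support.rtakeWhile (fun w => decide (R ≤ dist (meshPoint δ w) (D.pt 0))) ∈ T} +
              ENNReal.ofReal ε := by
  sorry

/-- **S2 — no deep return to the first marked point (along an approximation).** For every
Dobrushin domain `D`, approximation `(a, b)` (`IsEndpointApprox D a b`), every `s > 0` and `ε > 0`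
there is `R > 0` such that, eventually as `δ → 0⁺`, the `law_δ(a_δ, b_δ)`-probability that the walk
has a vertex at distance `≥ s` from `D.pt 0` followed later by a vertex at distance `< R` from
`D.pt 0` is at most `ε`. (The lattice shadow, concentric at the start, of "chordal SLE_{8/3} does
not revisit its starting prime end"; necessary for the conjunct.) -/
theorem stub_startConfinement :
    ∀ (D : DobrushinDomain) (a b : ℝ → Site 2), IsEndpointApprox D a b →
      ∀ (s ε : ℝ), 0 < s → 0 < ε →
        ∃ R : ℝ, 0 < R ∧ ∀ᶠ δ in 𝓝[>] (0 : ℝ),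
          law D.carrier δ (a δ) (b δ)
              {γ | ∃ i i' : ℕ, i < i' ∧ i' ≤ γ.walk.length ∧
                s ≤ dist (meshPoint δ (γ.walk.getVert i)) (D.pt 0) ∧
                dist (meshPoint δ (γ.walk.getVert i')) (D.pt 0) < R} ≤ ENNReal.ofReal ε := by
  sorry

/-! ### Consistency: each named statement IS its registered stub (definitionally) -/

theorem tailCoupling_holds : TailCoupling := stub_tailCoupling
theorem startConfinement_holds : StartConfinement := stub_startConfinement

/-! ### Name-keyed aliases of the two statements — the hypotheses of `EndpointCoupling_of`

The native skeleton audit (`#h21_check_skeleton`) admits a hypothesis of the skeleton theorem only if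
its head constant is a registered obligation or is NAMED like a declared stub; `__Registered.stub_X`
is the statement of `stub_X` under that name (device of `Cruxes/AxiomsOfLimit/Lines/birth.lean`).
Each alias is `rfl`-equal to its statement. -/
namespace __Registered

/-- Alias of `TailCoupling` keyed by the registered stub name. -/
abbrev stub_tailCoupling : Prop := TailCoupling
/-- Alias of `StartConfinement` keyed by the registered stub name. -/
abbrev stub_startConfinement : Prop := StartConfinement

end __Registered

/-! ### Proved glue of the line (no `sorry`) -/

/-- **The deep-return event** of a SAW about `c` at scales `R < s` (the event of S2, named): some
vertex at distance `≥ s` from `c` is followed later by a vertex at distance `< R`. -/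
def DeepReturn (δ : ℝ) (c : ℂ) (s R : ℝ) {Ω : Set ℂ} {x b : Site 2} (γ : DomainSAW Ω δ x b) : Prop :=
  ∃ i i' : ℕ, i < i' ∧ i' ≤ γ.walk.length ∧
    s ≤ dist (meshPoint δ (γ.walk.getVert i)) c ∧ dist (meshPoint δ (γ.walk.getVert i')) c < R

section Lists

variable {δ : ℝ} {c : ℂ}

/-- **Pre-tail vertices are close to the centre under "no deep return".** If a vertex list has no
pair of indices `i < i′` with the `i`-th mesh point at distance `≥ s` and the `i′`-th at distance
`< R` from `c` ("no deep return", support form) and `R ≤ s`, then every vertex BEFORE the exit tail —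
every element of `rdropWhile (R ≤ dist · c)`, i.e. up to and including the last visit to
`B(c, R)` — has its mesh point in `B(c, s)`. [folklore] -/
theorem dist_lt_of_mem_rdropWhile {R s : ℝ} (hRs : R ≤ s) (l : List (Site 2))
    (hnd : ¬ ∃ i i' : ℕ, ∃ (hi : i < l.length) (hi' : i' < l.length), i < i' ∧
      s ≤ dist (meshPoint δ (l[i])) c ∧ dist (meshPoint δ (l[i'])) c < R)
    {x : Site 2} (hx : x ∈ l.rdropWhile (fun w => decide (R ≤ dist (meshPoint δ w) c))) :
    dist (meshPoint δ x) c < s := by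
  set p : Site 2 → Bool := fun w => decide (R ≤ dist (meshPoint δ w) c) with hp
  have hPne : l.rdropWhile p ≠ [] := List.ne_nil_of_mem hx
  have hpre : l.rdropWhile p <+: l := List.rdropWhile_prefix p l
  have hlen : (l.rdropWhile p).length ≤ l.length := hpre.length_le
  have hpos : 0 < (l.rdropWhile p).length := List.length_pos_iff.2 hPne
  -- the last pre-tail vertex is inside `B(c, R)`
  have hlast : dist (meshPoint δ ((l.rdropWhile p).getLast hPne)) c < R := by
    have h := List.rdropWhile_last_not p l hPne
    simpa [hp] using h
  obtain ⟨i, hi, rfl⟩ := List.getElem_of_mem hx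
  by_contra hge
  push Not at hge
  rcases Nat.lt_or_ge i ((l.rdropWhile p).length - 1) with hlt | hge'
  · -- a deep return between `i` and the last pre-tail vertex
    apply hnd
    refine ⟨i, (l.rdropWhile p).length - 1, by omega, by omega, hlt, ?_, ?_⟩
    · have e : (l.rdropWhile p)[i] = l[i]'(by omega) := hpre.getElem hi
      calc s ≤ dist (meshPoint δ (l.rdropWhile p)[i]) c := hge
        _ = dist (meshPoint δ (l[i]'(by omega))) c := by rw [e]
    · have e : (l.rdropWhile p).getLast hPne = l[(l.rdropWhile p).length - 1]'(by omega) := by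
        rw [List.getLast_eq_getElem]
        exact hpre.getElem (by omega)
      calc dist (meshPoint δ (l[(l.rdropWhile p).length - 1]'(by omega))) c
          = dist (meshPoint δ ((l.rdropWhile p).getLast hPne)) c := by rw [e]
        _ < R := hlast
  · -- `i` is the last pre-tail index
    have hi' : i = (l.rdropWhile p).length - 1 := by omega
    subst hi'
    rw [List.getLast_eq_getElem] at hlast
    linarith

/-- In a list `P ++ Q` with `Q ≠ []`, the entry at index `|P|` is the head of `Q`. [folklore] -/
theorem getElem_append_length_eq_head {α : Type*} (P Q : List α) (hQ : Q ≠ [])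
    (h : P.length < (P ++ Q).length) : (P ++ Q)[P.length] = Q.head hQ := by
  rw [List.getElem_append_right (le_refl _), List.head_eq_getElem]
  exact getElem_congr_idx (Nat.sub_self _)

end Lists

section Walks

variable {Ω : Set ℂ} {δ : ℝ} {c : ℂ}

/-- Consecutive vertices of a SAW have mesh points at distance `≤ δ`. [folklore] -/
theorem dist_getVert_succ_le (hδ : 0 ≤ δ) {x b : Site 2} (γ : DomainSAW Ω δ x b) {i : ℕ}
    (hi : i < γ.walk.length) :
    dist (meshPoint δ (γ.walk.getVert i)) (meshPoint δ (γ.walk.getVert (i + 1))) ≤ δ := by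
  have hadj := γ.walk.adj_getVert_succ hi
  obtain ⟨hm, -, -⟩ := discreteDomainGraph_adj_iff.1 hadj
  exact dist_meshPoint_le_of_adj hδ (meshGraph_adj_iff.1 hm).1

/-- **The exit tail of a walk started inside and ending outside `B(c, R)`**: the pre-tail part and
the tail are both non-empty, and the first tail vertex is within `R + δ` of `c` (it follows the last
visit to `B(c, R)` along a mesh edge). [folklore] -/
theorem exitTail_spec (hδ : 0 ≤ δ) {R : ℝ} {x b : Site 2} (hx : dist (meshPoint δ x) c < R)
    (hb : R ≤ dist (meshPoint δ b) c) (γ : DomainSAW Ω δ x b) :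
    γ.walk.support.rdropWhile (fun w => decide (R ≤ dist (meshPoint δ w) c)) ≠ [] ∧
      ∃ hQ : γ.walk.support.rtakeWhile (fun w => decide (R ≤ dist (meshPoint δ w) c)) ≠ [],
        dist (meshPoint δ ((γ.walk.support.rtakeWhile
          (fun w => decide (R ≤ dist (meshPoint δ w) c))).head hQ)) c ≤ R + δ := by
  set p : Site 2 → Bool := fun w => decide (R ≤ dist (meshPoint δ w) c) with hp
  have hlne : γ.walk.support ≠ [] := SimpleGraph.Walk.support_ne_nil _
  have hlen : γ.walk.support.length = γ.walk.length + 1 := SimpleGraph.Walk.length_support _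
  have hP : γ.walk.support.rdropWhile p ≠ [] := by
    intro h
    rw [List.rdropWhile_eq_nil_iff] at h
    have hx' := h x (SimpleGraph.Walk.start_mem_support _)
    simp only [hp, decide_eq_true_eq] at hx'
    linarith
  have hQ : γ.walk.support.rtakeWhile p ≠ [] := by
    intro h
    rw [List.rtakeWhile_eq_nil_iff] at h
    have hb' := h hlne
    rw [SimpleGraph.Walk.getLast_support] at hb'
    simp only [hp, decide_eq_true_eq] at hb'
    linarith
  refine ⟨hP, hQ, ?_⟩
  -- the last pre-tail vertex and the first tail vertex are consecutive vertices of the walk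
  have hdec : γ.walk.support = γ.walk.support.rdropWhile p ++ γ.walk.support.rtakeWhile p :=
    List.rdropWhile_append_rtakeWhile.symm
  have hk0 : 0 < (γ.walk.support.rdropWhile p).length := List.length_pos_iff.2 hP
  have hkl : (γ.walk.support.rdropWhile p).length < γ.walk.support.length := by
    have h1 := congrArg List.length hdec
    rw [List.length_append] at h1
    have hQl : 0 < (γ.walk.support.rtakeWhile p).length := List.length_pos_iff.2 hQ
    omega
  have h2 : γ.walk.getVert (γ.walk.support.rdropWhile p).length =
      (γ.walk.support.rtakeWhile p).head hQ := by
    rw [getVert_eq_getElem_support _ hkl, List.getElem_of_eq hdec hkl]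
    exact getElem_append_length_eq_head _ _ hQ _
  have h1 : γ.walk.getVert ((γ.walk.support.rdropWhile p).length - 1) =
      (γ.walk.support.rdropWhile p).getLast hP := by
    rw [getVert_eq_getElem_support _
      (by omega : (γ.walk.support.rdropWhile p).length - 1 < γ.walk.support.length),
      List.getLast_eq_getElem]
    exact ((List.rdropWhile_prefix p γ.walk.support).getElem (by omega)).symm
  have hin : dist (meshPoint δ ((γ.walk.support.rdropWhile p).getLast hP)) c < R := by
    have h := List.rdropWhile_last_not p γ.walk.support hP
    simpa [hp] using h
  have hstep : dist (meshPoint δ ((γ.walk.support.rdropWhile p).getLast hP))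
      (meshPoint δ ((γ.walk.support.rtakeWhile p).head hQ)) ≤ δ := by
    rw [← h1, ← h2]
    have h := dist_getVert_succ_le hδ γ (i := (γ.walk.support.rdropWhile p).length - 1) (by omega)
    rwa [Nat.sub_add_cancel hk0] at h
  calc dist (meshPoint δ ((γ.walk.support.rtakeWhile p).head hQ)) c
      ≤ dist (meshPoint δ ((γ.walk.support.rtakeWhile p).head hQ))
            (meshPoint δ ((γ.walk.support.rdropWhile p).getLast hP)) +
          dist (meshPoint δ ((γ.walk.support.rdropWhile p).getLast hP)) c := dist_triangle _ _ _
    _ ≤ δ + R := add_le_add (by rw [dist_comm]; exact hstep) hin.le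
    _ = R + δ := add_comm _ _

/-- **Equal exit tails + no deep return on both sides ⇒ close curves.** Two SAWs to a common
target outside `B(c, R)`, the first started inside `B(c, R)`, with NO deep return from distance `s`
into `B(c, R)` (`R + δ ≤ s`) and with the SAME exit tail out of `B(c, R)`, have curve classes at
distance `≤ 2s`: their supports are `pfx₁ ++ tail`, `pfx₂ ++ tail` with all pre-tail vertices and
the first tail vertex in `B̄(c, s)` (`dist_curve_le_of_common_suffix`). (Only one start needs to be
inside the ball: it locates the first tail vertex; the pre-tail parts are confined by "no deep
return" alone.) [folklore] -/
theorem dist_curve_le_of_exitTail_eq (hδ : 0 ≤ δ) {R s : ℝ} (hRδs : R + δ ≤ s) {x₁ x₂ b : Site 2}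
    (hx₁ : dist (meshPoint δ x₁) c < R)
    (hb : R ≤ dist (meshPoint δ b) c) (γ₁ : DomainSAW Ω δ x₁ b) (γ₂ : DomainSAW Ω δ x₂ b)
    (hnd₁ : ¬ DeepReturn δ c s R γ₁) (hnd₂ : ¬ DeepReturn δ c s R γ₂)
    (h : exitTail δ R c γ₁.walk.support = exitTail δ R c γ₂.walk.support) :
    dist γ₁.curve γ₂.curve ≤ 2 * s := by
  have hR0 : 0 < R := lt_of_le_of_lt dist_nonneg hx₁
  have hRs' : R ≤ s := by linarith
  obtain ⟨-, hQ₁, hhead₁⟩ := exitTail_spec (Ω := Ω) (c := c) hδ hx₁ hb γ₁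
  have h₁ : γ₁.walk.support =
      γ₁.walk.support.rdropWhile (fun w => decide (R ≤ dist (meshPoint δ w) c)) ++
        exitTail δ R c γ₁.walk.support :=
    List.rdropWhile_append_rtakeWhile.symm
  have h₂ : γ₂.walk.support =
      γ₂.walk.support.rdropWhile (fun w => decide (R ≤ dist (meshPoint δ w) c)) ++
        exitTail δ R c γ₁.walk.support := by
    rw [h]
    exact List.rdropWhile_append_rtakeWhile.symm
  -- support form of "no deep return"
  have hnd₁' := fun h' => hnd₁ ((deepReturn_walk_iff (δ := δ) (c := c) γ₁.walk s R).2 h')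
  have hnd₂' := fun h' => hnd₂ ((deepReturn_walk_iff (δ := δ) (c := c) γ₂.walk s R).2 h')
  refine dist_curve_le_of_common_suffix γ₁ γ₂ _ _ _ h₁ h₂ hQ₁ (z₀ := c) (by linarith) ?_ ?_ ?_
  · exact mem_closedBall.2 (hhead₁.trans hRδs)
  · intro w hw
    exact mem_closedBall.2 (dist_lt_of_mem_rdropWhile hRs' _ hnd₁' hw).le
  · intro w hw
    exact mem_closedBall.2 (dist_lt_of_mem_rdropWhile hRs' _ hnd₂' hw).le

end Walks

/-! ### The Lévy–Prokhorov bound at a fixed mesh, and the one-endpoint coupling -/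

section FixedMesh

variable {Ω : Set ℂ} {δ : ℝ} {c : ℂ}

/-- **`d_LP ≤ max (2s) (3e)` from tail closeness and confinement** (fixed mesh). For two SAW laws
to a common target `b` outside `B(c, R)`, the first start inside `B(c, R)`: if the exit-tail laws are
`e`-close on all sets both ways and each deep-return event `(s, R)` has mass `≤ e` (`R + δ ≤ s`),
then the curve laws are at Lévy–Prokhorov distance `≤ max (2s) (3e)`. Proof: the sentinel tail
observable (exit tail on the no-deep-return event, the walk itself tagged by its side off it) has
`3e`-close laws on all sets and equal values force curves within `2s`; apply
`levyProkhorovEDist_map_le_of_tail`. [folklore] -/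
theorem levyProkhorovEDist_le_of_tails (hδ : 0 ≤ δ) {R s e : ℝ} (hRδs : R + δ ≤ s) (he : 0 ≤ e)
    {x₁ x₂ b : Site 2} (hx₁ : dist (meshPoint δ x₁) c < R) (hb : R ≤ dist (meshPoint δ b) c)
    (hT₁₂ : ∀ T : Set (List (Site 2)), law Ω δ x₁ b {γ | exitTail δ R c γ.walk.support ∈ T} ≤
      law Ω δ x₂ b {γ | exitTail δ R c γ.walk.support ∈ T} + ENNReal.ofReal e)
    (hT₂₁ : ∀ T : Set (List (Site 2)), law Ω δ x₂ b {γ | exitTail δ R c γ.walk.support ∈ T} ≤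
      law Ω δ x₁ b {γ | exitTail δ R c γ.walk.support ∈ T} + ENNReal.ofReal e)
    (hB₁ : law Ω δ x₁ b {γ | DeepReturn δ c s R γ} ≤ ENNReal.ofReal e)
    (hB₂ : law Ω δ x₂ b {γ | DeepReturn δ c s R γ} ≤ ENNReal.ofReal e) :
    levyProkhorovEDist ((law Ω δ x₁ b).map fun γ => γ.curve) ((law Ω δ x₂ b).map fun γ => γ.curve) ≤
      max (ENNReal.ofReal (2 * s)) (ENNReal.ofReal (3 * e)) := by
  classical
  -- sentinel-valued tails: bad walks are sent to themselves, tagged by their side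
  set Φ₁ : DomainSAW Ω δ x₁ b → List (Site 2) ⊕ (DomainSAW Ω δ x₁ b ⊕ DomainSAW Ω δ x₂ b) :=
    fun γ => if DeepReturn δ c s R γ then Sum.inr (Sum.inl γ)
      else Sum.inl (exitTail δ R c γ.walk.support) with hΦ₁
  set Φ₂ : DomainSAW Ω δ x₂ b → List (Site 2) ⊕ (DomainSAW Ω δ x₁ b ⊕ DomainSAW Ω δ x₂ b) :=
    fun γ => if DeepReturn δ c s R γ then Sum.inr (Sum.inr γ)
      else Sum.inl (exitTail δ R c γ.walk.support) with hΦ₂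
  have h3e : ENNReal.ofReal e + ENNReal.ofReal e + ENNReal.ofReal e = ENNReal.ofReal (3 * e) := by
    rw [← ENNReal.ofReal_add he he, ← ENNReal.ofReal_add (by positivity) he]
    congr 1
    ring
  refine levyProkhorovEDist_map_le_of_tail _ _ (DomainSAW.measurable_of_top _)
    (DomainSAW.measurable_of_top _) Φ₁ Φ₂ (fun γ₁ γ₂ hΦ => ?_) (fun A => ?_) (fun A => ?_)
  · -- equal sentinel tails force close curves
    by_cases hb₁ : DeepReturn δ c s R γ₁
    · by_cases hb₂ : DeepReturn δ c s R γ₂ <;> simp [hΦ₁, hΦ₂, hb₁, hb₂] at hΦ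
    · by_cases hb₂ : DeepReturn δ c s R γ₂
      · simp [hΦ₁, hΦ₂, hb₁, hb₂] at hΦ
      · simp only [hΦ₁, hΦ₂, hb₁, hb₂, if_false, Sum.inl.injEq] at hΦ
        rw [edist_dist]
        exact ENNReal.ofReal_le_ofReal
          (dist_curve_le_of_exitTail_eq hδ hRδs hx₁ hb γ₁ γ₂ hb₁ hb₂ hΦ)
  · -- `Φ`-laws are `3e`-close on all sets, one way …
    have hsub₁ : Φ₁ ⁻¹' A ⊆ {γ | exitTail δ R c γ.walk.support ∈ Sum.inl ⁻¹' A} ∪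
        {γ | DeepReturn δ c s R γ} := by
      intro γ hγ
      by_cases hbad : DeepReturn δ c s R γ
      · exact Or.inr hbad
      · left
        have hγ' : Φ₁ γ ∈ A := hγ
        simp only [hΦ₁, hbad, if_false] at hγ'
        exact hγ'
    have hsub₂ : {γ : DomainSAW Ω δ x₂ b | exitTail δ R c γ.walk.support ∈ Sum.inl ⁻¹' A} ⊆
        Φ₂ ⁻¹' A ∪ {γ | DeepReturn δ c s R γ} := by
      intro γ hγ
      by_cases hbad : DeepReturn δ c s R γ
      · exact Or.inr hbad
      · left
        show Φ₂ γ ∈ A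
        simp only [hΦ₂, hbad, if_false]
        exact hγ
    calc law Ω δ x₁ b (Φ₁ ⁻¹' A)
        ≤ law Ω δ x₁ b ({γ | exitTail δ R c γ.walk.support ∈ Sum.inl ⁻¹' A} ∪
            {γ | DeepReturn δ c s R γ}) := measure_mono hsub₁
      _ ≤ law Ω δ x₁ b {γ | exitTail δ R c γ.walk.support ∈ Sum.inl ⁻¹' A} +
            law Ω δ x₁ b {γ | DeepReturn δ c s R γ} := measure_union_le _ _
      _ ≤ (law Ω δ x₂ b {γ | exitTail δ R c γ.walk.support ∈ Sum.inl ⁻¹' A} + ENNReal.ofReal e) +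
            ENNReal.ofReal e := add_le_add (hT₁₂ _) hB₁
      _ ≤ ((law Ω δ x₂ b (Φ₂ ⁻¹' A) + law Ω δ x₂ b {γ | DeepReturn δ c s R γ}) +
            ENNReal.ofReal e) + ENNReal.ofReal e :=
          add_le_add (add_le_add ((measure_mono hsub₂).trans (measure_union_le _ _)) le_rfl) le_rfl
      _ ≤ ((law Ω δ x₂ b (Φ₂ ⁻¹' A) + ENNReal.ofReal e) + ENNReal.ofReal e) + ENNReal.ofReal e :=
          add_le_add (add_le_add (add_le_add le_rfl hB₂) le_rfl) le_rfl
      _ = law Ω δ x₂ b (Φ₂ ⁻¹' A) + (ENNReal.ofReal e + ENNReal.ofReal e + ENNReal.ofReal e) := by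
          ring
      _ = law Ω δ x₂ b (Φ₂ ⁻¹' A) + ENNReal.ofReal (3 * e) := by rw [h3e]
  · -- … and the other way
    have hsub₁ : Φ₂ ⁻¹' A ⊆ {γ | exitTail δ R c γ.walk.support ∈ Sum.inl ⁻¹' A} ∪
        {γ | DeepReturn δ c s R γ} := by
      intro γ hγ
      by_cases hbad : DeepReturn δ c s R γ
      · exact Or.inr hbad
      · left
        have hγ' : Φ₂ γ ∈ A := hγ
        simp only [hΦ₂, hbad, if_false] at hγ'
        exact hγ'
    have hsub₂ : {γ : DomainSAW Ω δ x₁ b | exitTail δ R c γ.walk.support ∈ Sum.inl ⁻¹' A} ⊆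
        Φ₁ ⁻¹' A ∪ {γ | DeepReturn δ c s R γ} := by
      intro γ hγ
      by_cases hbad : DeepReturn δ c s R γ
      · exact Or.inr hbad
      · left
        show Φ₁ γ ∈ A
        simp only [hΦ₁, hbad, if_false]
        exact hγ
    calc law Ω δ x₂ b (Φ₂ ⁻¹' A)
        ≤ law Ω δ x₂ b ({γ | exitTail δ R c γ.walk.support ∈ Sum.inl ⁻¹' A} ∪
            {γ | DeepReturn δ c s R γ}) := measure_mono hsub₁
      _ ≤ law Ω δ x₂ b {γ | exitTail δ R c γ.walk.support ∈ Sum.inl ⁻¹' A} +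
            law Ω δ x₂ b {γ | DeepReturn δ c s R γ} := measure_union_le _ _
      _ ≤ (law Ω δ x₁ b {γ | exitTail δ R c γ.walk.support ∈ Sum.inl ⁻¹' A} + ENNReal.ofReal e) +
            ENNReal.ofReal e := add_le_add (hT₂₁ _) hB₂
      _ ≤ ((law Ω δ x₁ b (Φ₁ ⁻¹' A) + law Ω δ x₁ b {γ | DeepReturn δ c s R γ}) +
            ENNReal.ofReal e) + ENNReal.ofReal e :=
          add_le_add (add_le_add ((measure_mono hsub₂).trans (measure_union_le _ _)) le_rfl) le_rfl
      _ ≤ ((law Ω δ x₁ b (Φ₁ ⁻¹' A) + ENNReal.ofReal e) + ENNReal.ofReal e) + ENNReal.ofReal e :=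
          add_le_add (add_le_add (add_le_add le_rfl hB₁) le_rfl) le_rfl
      _ = law Ω δ x₁ b (Φ₁ ⁻¹' A) + (ENNReal.ofReal e + ENNReal.ofReal e + ENNReal.ofReal e) := by
          ring
      _ = law Ω δ x₁ b (Φ₁ ⁻¹' A) + ENNReal.ofReal (3 * e) := by rw [h3e]

end FixedMesh

/-- **S1 + S2 ⇒ one-endpoint coupling at the first marked point**, for every Dobrushin domain.
Fix `ε > 0`; `s = ε/8`; S2 for `(a, b)` and `(a′, b)` at `(s, ε/16)` gives `R₁, R₂`; put
`R = min(R₁, R₂, s/2, |pt 1 − pt 0|/2)`; S1 at `(R, ε/16)` both ways. For small `δ` the start `a_δ` is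
inside `B(pt 0, R)`, the target outside, `R + δ ≤ s`, and `levyProkhorovEDist_le_of_tails` gives
`d_LP ≤ max(ε/4, 3ε/16) ≤ ε/2 < ε`. [folklore; Billingsley 1999 Thm 3.1, lattice form] -/
theorem startCoupling_of (h₁ : TailCoupling) (h₂ : StartConfinement) : StartCoupling := by
  intro D a a' b hab ha'b
  rw [Metric.tendsto_nhds]
  intro ε hε
  -- constants
  set s : ℝ := ε / 8 with hs
  have hs0 : 0 < s := by positivity
  set e : ℝ := ε / 16 with he
  have he0 : 0 < e := by positivity
  obtain ⟨R₁, hR₁, ev₁⟩ := h₂ D a b hab s e hs0 he0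
  obtain ⟨R₂, hR₂, ev₂⟩ := h₂ D a' b ha'b s e hs0 he0
  set L : ℝ := dist (D.pt 1) (D.pt 0) with hL
  have hL0 : 0 < L := dist_pos.2 (D.pt_injective.ne (by decide))
  set R : ℝ := min (min R₁ R₂) (min (s / 2) (L / 2)) with hRdef
  have hR0 : 0 < R := lt_min (lt_min hR₁ hR₂) (lt_min (by positivity) (by positivity))
  have hRR₁ : R ≤ R₁ := (min_le_left _ _).trans (min_le_left _ _)
  have hRR₂ : R ≤ R₂ := (min_le_left _ _).trans (min_le_right _ _)
  have hRs : R ≤ s / 2 := (min_le_right _ _).trans (min_le_left _ _)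
  have hRL : R ≤ L / 2 := (min_le_right _ _).trans (min_le_right _ _)
  have ev₃ := h₁ D a a' b hab ha'b R e hR0 he0
  have ev₄ := h₁ D a' a b ha'b hab R e hR0 he0
  have ev₅ : ∀ᶠ δ in 𝓝[>] (0 : ℝ), 0 < δ := eventually_mem_nhdsWithin
  have ev₆ : ∀ᶠ δ in 𝓝[>] (0 : ℝ), δ < s / 2 :=
    (eventually_lt_nhds (half_pos hs0)).filter_mono nhdsWithin_le_nhds
  have ev₇ : ∀ᶠ δ in 𝓝[>] (0 : ℝ), dist (meshPoint δ (a δ)) (D.pt 0) < R :=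
    Metric.tendsto_nhds.1 hab.tendsto_fst R hR0
  have ev₈ : ∀ᶠ δ in 𝓝[>] (0 : ℝ), dist (meshPoint δ (b δ)) (D.pt 1) < L / 2 :=
    Metric.tendsto_nhds.1 hab.tendsto_snd (L / 2) (by positivity)
  filter_upwards [ev₁, ev₂, ev₃, ev₄, ev₅, ev₆, ev₇, ev₈]
    with δ hbad₁ hbad₂ hT₁₂ hT₂₁ hδ hδs haδ hbδ
  have hbR : R ≤ dist (meshPoint δ (b δ)) (D.pt 0) := by
    have h1 := dist_triangle (D.pt 1) (meshPoint δ (b δ)) (D.pt 0)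
    have h2 := dist_comm (D.pt 1) (meshPoint δ (b δ))
    linarith
  have hRδs : R + δ ≤ s := by linarith
  -- the deep-return events at radius `R` have mass `≤ e` (monotonicity in the radius, then S2)
  have hB₁ : law D.carrier δ (a δ) (b δ) {γ | DeepReturn δ (D.pt 0) s R γ} ≤ ENNReal.ofReal e := by
    refine (measure_mono ?_).trans hbad₁
    rintro γ ⟨i, i', hii', hi', hfar, hnear⟩
    exact ⟨i, i', hii', hi', hfar, hnear.trans_le hRR₁⟩
  have hB₂ : law D.carrier δ (a' δ) (b δ) {γ | DeepReturn δ (D.pt 0) s R γ} ≤ ENNReal.ofReal e := by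
    refine (measure_mono ?_).trans hbad₂
    rintro γ ⟨i, i', hii', hi', hfar, hnear⟩
    exact ⟨i, i', hii', hi', hfar, hnear.trans_le hRR₂⟩
  have hLP := levyProkhorovEDist_le_of_tails (Ω := D.carrier) (c := D.pt 0) hδ.le hRδs he0.le
    haδ hbR hT₁₂ hT₂₁ hB₁ hB₂
  -- conclusion: `d_LP ≤ max (ε/4) (3ε/16) ≤ ε/2 < ε`
  have hnn : 0 ≤ levyProkhorovDist ((law D.carrier δ (a δ) (b δ)).map fun γ => γ.curve)
      ((law D.carrier δ (a' δ) (b δ)).map fun γ => γ.curve) := ENNReal.toReal_nonneg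
  rw [Real.dist_0_eq_abs, abs_of_nonneg hnn]
  have hmax : max (ENNReal.ofReal (2 * s)) (ENNReal.ofReal (3 * e)) ≤ ENNReal.ofReal (ε / 2) :=
    max_le (ENNReal.ofReal_le_ofReal (by rw [hs]; linarith))
      (ENNReal.ofReal_le_ofReal (by rw [he]; linarith))
  calc levyProkhorovDist ((law D.carrier δ (a δ) (b δ)).map fun γ => γ.curve)
        ((law D.carrier δ (a' δ) (b δ)).map fun γ => γ.curve)
      ≤ ε / 2 := ENNReal.toReal_le_of_le_ofReal (by positivity) (hLP.trans hmax)
    _ < ε := by linarith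

/-! ### The skeleton theorem: the two stubs imply the crux, BY NAME -/

/-- **`EndpointCoupling` from the line `birth`** (kernel-checked, no `sorry` of its own): the two
stubs give the one-endpoint coupling at the first marked point of EVERY Dobrushin domain
(`startCoupling_of`); for approximations `(a, b)`, `(a′, b′)` pass through `law_δ(a′, b)` (an
approximation by `isEndpointApprox_cross`): couple the starts in `D`, couple the targets as starts of
the swapped domain `D.swap = (D; b, a)` read through exact lattice reversibility
(`map_curve_law_swap`) and the isometry `CurveClass.reverse` of curve classes; the triangle
inequality for `d_LP` past the junk meshes (`eventually_isProbabilityMeasure_law`) concludes.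
Hypotheses = the two stubs under their registered names; conclusion = the route decl. -/
theorem EndpointCoupling_of (h₁ : __Registered.stub_tailCoupling)
    (h₂ : __Registered.stub_startConfinement) :
    Summit.CriticalPhenomena.SAWScalingLimit.Theses.SAWCircleScreening.EndpointCoupling := by
  have H : StartCoupling := startCoupling_of h₁ h₂
  intro D a b a' b' hab hab'
  have hab'b : IsEndpointApprox D a' b := isEndpointApprox_cross hab hab'
  -- `pt 0`: couple the starts
  have T1 := H D a a' b hab hab'b
  -- `pt 1`: couple the targets, by reversal in the swapped domain
  have T2' := H D.swap b b' a' (isEndpointApprox_swap hab'b) (isEndpointApprox_swap hab')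
  have hrev : ∀ (δ : ℝ) (e f : Site 2),
      (law D.carrier δ f e).map (fun γ => γ.curve) =
        ((law D.carrier δ e f).map fun γ => γ.curve).map CurveClass.reverse :=
    fun δ e f => map_curve_law_swap
  have hiso : ∀ μ ν : Measure (CurveClass ℂ),
      levyProkhorovDist (μ.map CurveClass.reverse) (ν.map CurveClass.reverse) =
        levyProkhorovDist μ ν := fun μ ν => by
    unfold levyProkhorovDist
    rw [levyProkhorovEDist_map_eq_of_isometry CurveClass.isometry_reverse.lipschitz
      CurveClass.isometry_reverse.lipschitz CurveClass.measurable_reverse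
      CurveClass.measurable_reverse CurveClass.reverse_reverse]
  have T2 : Tendsto (fun δ => levyProkhorovDist
      ((law D.carrier δ (a' δ) (b δ)).map fun γ => γ.curve)
      ((law D.carrier δ (a' δ) (b' δ)).map fun γ => γ.curve)) (𝓝[>] (0 : ℝ)) (𝓝 0) := by
    refine T2'.congr fun δ => ?_
    change levyProkhorovDist ((law D.carrier δ (b δ) (a' δ)).map fun γ => γ.curve)
      ((law D.carrier δ (b' δ) (a' δ)).map fun γ => γ.curve) = _
    rw [hrev δ (a' δ) (b δ), hrev δ (a' δ) (b' δ), hiso]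
  -- triangle inequality, past the junk meshes
  have hPa := eventually_isProbabilityMeasure_law hab
  have hPa'b := eventually_isProbabilityMeasure_law hab'b
  have hPa' := eventually_isProbabilityMeasure_law hab'
  have hsum := T1.add T2
  rw [add_zero] at hsum
  refine squeeze_zero' (Eventually.of_forall fun δ => ENNReal.toReal_nonneg) ?_ hsum
  filter_upwards [hPa, hPa'b, hPa'] with δ hp₁ hp₂ hp₃
  haveI := hp₁
  haveI := hp₂
  haveI := hp₃
  haveI : IsProbabilityMeasure ((law D.carrier δ (a δ) (b δ)).map fun γ => γ.curve) :=
    Measure.isProbabilityMeasure_map (aemeasurable_curve _ _ _ _)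
  haveI : IsProbabilityMeasure ((law D.carrier δ (a' δ) (b δ)).map fun γ => γ.curve) :=
    Measure.isProbabilityMeasure_map (aemeasurable_curve _ _ _ _)
  haveI : IsProbabilityMeasure ((law D.carrier δ (a' δ) (b' δ)).map fun γ => γ.curve) :=
    Measure.isProbabilityMeasure_map (aemeasurable_curve _ _ _ _)
  exact levyProkhorovDist_triangle _ _ _

/-- Wiring check (an `example`, so that `EndpointCoupling_of` stays the only theorem concluding the
crux): the registered stubs, with their tree-vocabulary types, feed the skeleton theorem as stated —
this term becomes the crux proof when the two `sorry`s above are discharged. -/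
example : Summit.CriticalPhenomena.SAWScalingLimit.Theses.SAWCircleScreening.EndpointCoupling :=
  EndpointCoupling_of stub_tailCoupling stub_startConfinement

end Summit.CriticalPhenomena.SAWScalingLimit.Cruxes.EndpointCoupling.Birth

end
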